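import Summits.PneNP.PneNP.Theorems.KarlinRubinMonotoneBlindDnfWitness

/-!
# Route KarlinRubin, crux `MonotoneBlind` (stmt-PneNP-18027): planted acceptance of a monotone DNF (DNF line, level 2)

Probability form (in `ℝ≥0∞`, per `n`) of the witness-lemma bound for monotone DNFs under the planted-clique pair
(`G(n,1/2)` versus `G(n,1/2) ∪ K_A`, `A` uniform in `kSubsets n k`), built on the counting lemmas of
`KarlinRubinMonotoneBlindDnfWitness.lean`:

* `erdosRenyiHalf_toOuterMeasure_eq_card_div`, `plantedCliqueDist_toOuterMeasure_eq_sum` — the two laws as counts /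
  fibre sums;
* `dnf_planted_le_of_termBound` — **master inequality**: for every `t`,
  `Pr_planted[f_𝓔 = 1] ≤ 2^t · Pr_null[f_𝓔 = 1] + Σ_{E ∈ 𝓔} β(E)` whenever `β(E)` bounds the heavy-witness term
  `avg_A [t < t_A(E)] · Pr_x[E ⊆ plant A x]` of `E`;
* `dnf_termBound_tail` — with `t = C(j-1,2)`: heavy-witness term of `E` `≤ C(v_E, j) d^j / n^j` (`v_E` = number of
  vertices met by `E`, `d = min k n`);
* `dnf_termBound_large` — for any `t`: heavy-witness term of `E` `≤ 2^{-(|E| - C(a,2))} + C(v_E, a+1) d^{a+1}/n^{a+1}`,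
  `a = ⌊√|E|⌋`.

All `--supports stmt-PneNP-18027`; no definitions.
-/

set_option linter.dupNamespace false -- `Summit.PneNP.PneNP.…`: summit = sub-problem (D-0017)

namespace Summit.PneNP.PneNP.Theorems

open Finset
open scoped ENNReal
open Literature.Computability.Complexity
open Literature.Probability.RandomGraphs.PlantedClique

variable {n : ℕ}

/-! ### The two laws as counts -/

/-- `G(n,1/2)` is uniform: the measure of a set is its cardinality over `2^{C(n,2)}`. [folklore] -/
theorem erdosRenyiHalf_toOuterMeasure_eq_card_div (S : Set (EdgeVec n)) [DecidablePred (· ∈ S)] :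
    (erdosRenyiHalf n).toOuterMeasure S =
      (#(univ.filter fun x : EdgeVec n => x ∈ S) : ℝ≥0∞) / (Fintype.card (EdgeVec n) : ℝ≥0∞) := by
  classical
  rw [erdosRenyiHalf, PMF.uniformOfFintype, PMF.toOuterMeasure_uniformOfFinset_apply, card_univ]
  congr

/-- A count inequality `#S ≤ m · #T` is a probability inequality under `G(n,1/2)`. [folklore] -/
theorem erdosRenyiHalf_le_mul_of_card_le (S T : Set (EdgeVec n)) [DecidablePred (· ∈ S)]
    [DecidablePred (· ∈ T)] (m : ℕ)
    (h : #(univ.filter fun x : EdgeVec n => x ∈ S) ≤ m * #(univ.filter fun x : EdgeVec n => x ∈ T)) :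
    (erdosRenyiHalf n).toOuterMeasure S ≤ (m : ℝ≥0∞) * (erdosRenyiHalf n).toOuterMeasure T := by
  rw [erdosRenyiHalf_toOuterMeasure_eq_card_div, erdosRenyiHalf_toOuterMeasure_eq_card_div, mul_div_assoc']
  gcongr
  exact_mod_cast h

/-- A count inequality `#S · 2^a ≤ 2^{#slots}` reads `Pr_{G(n,1/2)}[S] ≤ 2^{-a}`. [folklore] -/
theorem erdosRenyiHalf_le_half_pow_of_card_mul_le (S : Set (EdgeVec n)) [DecidablePred (· ∈ S)] (a : ℕ)
    (h : #(univ.filter fun x : EdgeVec n => x ∈ S) * 2 ^ a ≤ 2 ^ Fintype.card (⊤ : SimpleGraph (Fin n)).edgeSet) :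
    (erdosRenyiHalf n).toOuterMeasure S ≤ 2⁻¹ ^ a := by
  have huniv : (Fintype.card (EdgeVec n) : ℝ≥0∞) = 2 ^ Fintype.card (⊤ : SimpleGraph (Fin n)).edgeSet := by
    rw [Fintype.card_fun, Fintype.card_bool]; push_cast; rfl
  have h2 : (2 : ℝ≥0∞) ^ a ≠ 0 := pow_ne_zero _ two_ne_zero
  have h2' : (2 : ℝ≥0∞) ^ a ≠ ⊤ := ENNReal.pow_ne_top ENNReal.ofNat_ne_top
  rw [erdosRenyiHalf_toOuterMeasure_eq_card_div, huniv,
    ENNReal.div_le_iff (pow_ne_zero _ two_ne_zero) (ENNReal.pow_ne_top ENNReal.ofNat_ne_top)]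
  calc (#(univ.filter fun x : EdgeVec n => x ∈ S) : ℝ≥0∞)
      = 2⁻¹ ^ a * ((#(univ.filter fun x : EdgeVec n => x ∈ S) : ℝ≥0∞) * 2 ^ a) := by
        rw [mul_comm _ ((2 : ℝ≥0∞) ^ a), ← mul_assoc, ← ENNReal.inv_pow, ENNReal.inv_mul_cancel h2 h2', one_mul]
    _ ≤ 2⁻¹ ^ a * 2 ^ Fintype.card (⊤ : SimpleGraph (Fin n)).edgeSet := by gcongr; exact_mod_cast h

/-- **The planted law, fibred over the planted set** (general events): `Pr_{G(n,1/2,k)}[S] =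
(#kSubsets)⁻¹ · Σ_{A ∈ kSubsets} Pr_{G(n,1/2)}[plant A x ∈ S]`. [folklore] -/
theorem plantedCliqueDist_toOuterMeasure_eq_sum (k : ℕ) (S : Set (EdgeVec n)) :
    (plantedCliqueDist n k).toOuterMeasure S =
      ((#(kSubsets n k) : ℕ) : ℝ≥0∞)⁻¹ *
        ∑ A ∈ kSubsets n k, (erdosRenyiHalf n).toOuterMeasure {x | plant A x ∈ S} := by
  classical
  rw [plantedCliqueDist, PMF.toOuterMeasure_map_apply, plantedCliqueJoint,
    PMF.toOuterMeasure_bind_apply, tsum_eq_sum (s := kSubsets n k)]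
  · rw [mul_sum]
    refine sum_congr rfl fun A hA => ?_
    rw [PMF.uniformOfFinset_apply, if_pos hA, PMF.toOuterMeasure_map_apply]
    rfl
  · intro A hA
    rw [PMF.uniformOfFinset_apply, if_neg hA, zero_mul]

/-- `#kSubsets ≠ 0` in `ℝ≥0∞`. [folklore] -/
theorem card_kSubsets_cast_ne_zero (n k : ℕ) : ((#(kSubsets n k) : ℕ) : ℝ≥0∞) ≠ 0 := by
  exact_mod_cast (kSubsets_nonempty n k).card_pos.ne'

/-! ### The master inequality -/

/-- **Master inequality for monotone DNFs under the planted-clique pair.** For every threshold `t`, the planted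
acceptance of `f_𝓔` is at most `2^t` times its null acceptance (witnesses with `≤ t` planted edges, by the witness
lemma `dnf_witness_count_mono`) plus, for each term `E`, any bound `β E` on its heavy-witness term
`(#kSubsets)⁻¹ Σ_A [t < t_A(E)] · Pr_x[E ⊆ plant A x]` (union bound over heavy witnesses). [folklore] -/
theorem dnf_planted_le_of_termBound (k t : ℕ) (𝓔 : Finset (Finset (⊤ : SimpleGraph (Fin n)).edgeSet)) (β : Finset (⊤ : SimpleGraph (Fin n)).edgeSet → ℝ≥0∞)
    (hβ : ∀ E ∈ 𝓔, ((#(kSubsets n k) : ℕ) : ℝ≥0∞)⁻¹ *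
      (∑ A ∈ kSubsets n k,
        if t < #(E.filter fun e : (⊤ : SimpleGraph (Fin n)).edgeSet => ∀ v ∈ (e : Sym2 (Fin n)), v ∈ A) then
          (erdosRenyiHalf n).toOuterMeasure {x | ∀ e ∈ E, plant A x e = true} else 0) ≤ β E) :
    (plantedCliqueDist n k).toOuterMeasure {x | ∃ E ∈ 𝓔, ∀ e ∈ E, x e = true} ≤
      2 ^ t * (erdosRenyiHalf n).toOuterMeasure {x | ∃ E ∈ 𝓔, ∀ e ∈ E, x e = true} +
        ∑ E ∈ 𝓔, β E := by
  classical
  set KS := kSubsets n k with hKS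
  set P0 := erdosRenyiHalf n with hP0
  set μ := P0.toOuterMeasure {x | ∃ E ∈ 𝓔, ∀ e ∈ E, x e = true} with hμ
  -- per planted set: light part (witness lemma) + heavy part (union bound)
  have hA : ∀ A ∈ KS, P0.toOuterMeasure {x | plant A x ∈ {x : EdgeVec n | ∃ E ∈ 𝓔, ∀ e ∈ E, x e = true}} ≤
      2 ^ t * μ + ∑ E ∈ 𝓔, if t < #(E.filter fun e : (⊤ : SimpleGraph (Fin n)).edgeSet => ∀ v ∈ (e : Sym2 (Fin n)), v ∈ A) then
          P0.toOuterMeasure {x | ∀ e ∈ E, plant A x e = true} else 0 := by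
    intro A _
    set Light := 𝓔.filter fun E => #(E.filter fun e : (⊤ : SimpleGraph (Fin n)).edgeSet => ∀ v ∈ (e : Sym2 (Fin n)), v ∈ A) ≤ t with hLight
    set Heavy := 𝓔.filter fun E => t < #(E.filter fun e : (⊤ : SimpleGraph (Fin n)).edgeSet => ∀ v ∈ (e : Sym2 (Fin n)), v ∈ A) with hHeavy
    have hsplit : {x | plant A x ∈ {x : EdgeVec n | ∃ E ∈ 𝓔, ∀ e ∈ E, x e = true}} ⊆
        {x | ∃ E ∈ Light, ∀ e ∈ E, plant A x e = true} ∪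
          ⋃ E ∈ Heavy, {x | ∀ e ∈ E, plant A x e = true} := by
      intro x hx
      simp only [Set.mem_setOf_eq] at hx
      obtain ⟨E, hE, hEx⟩ := hx
      by_cases hlt : t < #(E.filter fun e : (⊤ : SimpleGraph (Fin n)).edgeSet => ∀ v ∈ (e : Sym2 (Fin n)), v ∈ A)
      · refine Or.inr (Set.mem_biUnion (x := E) ?_ hEx)
        exact mem_filter.2 ⟨hE, hlt⟩
      · exact Or.inl ⟨E, mem_filter.2 ⟨hE, not_lt.1 hlt⟩, hEx⟩
    have hlight : P0.toOuterMeasure {x | ∃ E ∈ Light, ∀ e ∈ E, plant A x e = true} ≤ 2 ^ t * μ := by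
      have hcount := dnf_witness_count_mono A (filter_subset _ 𝓔) t (fun E hE => (mem_filter.1 hE).2)
      have hcount' : #(univ.filter fun x : EdgeVec n =>
            x ∈ {x : EdgeVec n | ∃ E ∈ Light, ∀ e ∈ E, plant A x e = true}) ≤
          2 ^ t * #(univ.filter fun x : EdgeVec n =>
            x ∈ {x : EdgeVec n | ∃ E ∈ 𝓔, ∀ e ∈ E, x e = true}) := by
        simpa only [Set.mem_setOf_eq] using hcount
      have h := erdosRenyiHalf_le_mul_of_card_le
        {x : EdgeVec n | ∃ E ∈ Light, ∀ e ∈ E, plant A x e = true}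
        {x : EdgeVec n | ∃ E ∈ 𝓔, ∀ e ∈ E, x e = true} (2 ^ t) hcount'
      rw [hμ, hP0]
      convert h using 2
      push_cast
      rfl
    have hheavy : P0.toOuterMeasure (⋃ E ∈ Heavy, {x | ∀ e ∈ E, plant A x e = true}) ≤
        ∑ E ∈ 𝓔, if t < #(E.filter fun e : (⊤ : SimpleGraph (Fin n)).edgeSet => ∀ v ∈ (e : Sym2 (Fin n)), v ∈ A) then
          P0.toOuterMeasure {x | ∀ e ∈ E, plant A x e = true} else 0 := by
      calc P0.toOuterMeasure (⋃ E ∈ Heavy, {x | ∀ e ∈ E, plant A x e = true})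
          ≤ ∑ E ∈ Heavy, P0.toOuterMeasure {x | ∀ e ∈ E, plant A x e = true} :=
            MeasureTheory.measure_biUnion_finset_le _ _
        _ = _ := by rw [hHeavy, sum_filter]
    calc P0.toOuterMeasure {x | plant A x ∈ {x : EdgeVec n | ∃ E ∈ 𝓔, ∀ e ∈ E, x e = true}}
        ≤ P0.toOuterMeasure ({x | ∃ E ∈ Light, ∀ e ∈ E, plant A x e = true} ∪
            ⋃ E ∈ Heavy, {x | ∀ e ∈ E, plant A x e = true}) := P0.toOuterMeasure.mono hsplit
      _ ≤ P0.toOuterMeasure {x | ∃ E ∈ Light, ∀ e ∈ E, plant A x e = true} +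
            P0.toOuterMeasure (⋃ E ∈ Heavy, {x | ∀ e ∈ E, plant A x e = true}) :=
          MeasureTheory.measure_union_le _ _
      _ ≤ _ := add_le_add hlight hheavy
  -- average over the planted set
  have hne := card_kSubsets_cast_ne_zero n k
  have htop : ((#KS : ℕ) : ℝ≥0∞) ≠ ⊤ := ENNReal.natCast_ne_top _
  rw [plantedCliqueDist_toOuterMeasure_eq_sum]
  calc ((#KS : ℕ) : ℝ≥0∞)⁻¹ * ∑ A ∈ KS, P0.toOuterMeasure
          {x | plant A x ∈ {x : EdgeVec n | ∃ E ∈ 𝓔, ∀ e ∈ E, x e = true}}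
      ≤ ((#KS : ℕ) : ℝ≥0∞)⁻¹ * ∑ A ∈ KS, (2 ^ t * μ +
          ∑ E ∈ 𝓔, if t < #(E.filter fun e : (⊤ : SimpleGraph (Fin n)).edgeSet => ∀ v ∈ (e : Sym2 (Fin n)), v ∈ A) then
            P0.toOuterMeasure {x | ∀ e ∈ E, plant A x e = true} else 0) := by
        gcongr with A hAKS
        exact hA A hAKS
    _ = 2 ^ t * μ + ∑ E ∈ 𝓔, ((#KS : ℕ) : ℝ≥0∞)⁻¹ * ∑ A ∈ KS,
          (if t < #(E.filter fun e : (⊤ : SimpleGraph (Fin n)).edgeSet => ∀ v ∈ (e : Sym2 (Fin n)), v ∈ A) then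
            P0.toOuterMeasure {x | ∀ e ∈ E, plant A x e = true} else 0) := by
        rw [sum_add_distrib, sum_const, nsmul_eq_mul, mul_add, ← mul_assoc,
          ENNReal.inv_mul_cancel hne htop, one_mul, sum_comm, mul_sum]
    _ ≤ 2 ^ t * μ + ∑ E ∈ 𝓔, β E := by
        gcongr with E hE
        exact hβ E hE

/-! ### Bounding the heavy-witness term of one term -/

/-- Averages of indicator-bounded summands over `kSubsets`: if each summand is `≤ 1` on a set `Q` of planted sets
and `0` elsewhere, the average is `≤ (#kSubsets)⁻¹ · #Q`. [folklore] -/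
theorem avg_kSubsets_le_card_filter (k : ℕ) (g : Finset (Fin n) → ℝ≥0∞) (Q : Finset (Fin n) → Prop)
    [DecidablePred Q] (hg : ∀ A ∈ kSubsets n k, g A ≤ if Q A then 1 else 0) :
    ((#(kSubsets n k) : ℕ) : ℝ≥0∞)⁻¹ * ∑ A ∈ kSubsets n k, g A ≤
      ((#(kSubsets n k) : ℕ) : ℝ≥0∞)⁻¹ * ((#((kSubsets n k).filter Q) : ℕ) : ℝ≥0∞) := by
  gcongr
  calc ∑ A ∈ kSubsets n k, g A ≤ ∑ A ∈ kSubsets n k, (if Q A then (1 : ℝ≥0∞) else 0) := sum_le_sum hg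
    _ = ((#((kSubsets n k).filter Q) : ℕ) : ℝ≥0∞) := by
        rw [← sum_filter, sum_const, nsmul_eq_mul, mul_one]

/-- **The hypergeometric tail in probability form.** `(#kSubsets)⁻¹ · #{A : q ≤ |A ∩ V|} ≤ C(|V|,q) d^q / n^q`
(`d = min k n`, `0 < n`). [folklore] -/
theorem avg_kSubsets_card_inter_ge_le (hn : 0 < n) (k q : ℕ) (V : Finset (Fin n)) :
    ((#(kSubsets n k) : ℕ) : ℝ≥0∞)⁻¹ * ((#((kSubsets n k).filter fun A => q ≤ #(A ∩ V)) : ℕ) : ℝ≥0∞) ≤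
      (((#V).choose q * (min k n) ^ q : ℕ) : ℝ≥0∞) / ((n ^ q : ℕ) : ℝ≥0∞) := by
  have hcount := card_kSubsets_filter_le_card_inter_mul_le V k q
  have hne := card_kSubsets_cast_ne_zero n k
  have htop : ((#(kSubsets n k) : ℕ) : ℝ≥0∞) ≠ ⊤ := ENNReal.natCast_ne_top _
  have hnq : ((n ^ q : ℕ) : ℝ≥0∞) ≠ 0 := by exact_mod_cast (pow_pos hn q).ne'
  have hnq' : ((n ^ q : ℕ) : ℝ≥0∞) ≠ ⊤ := ENNReal.natCast_ne_top _
  rw [ENNReal.le_div_iff_mul_le (Or.inl hnq) (Or.inl hnq'), mul_assoc]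
  calc ((#(kSubsets n k) : ℕ) : ℝ≥0∞)⁻¹ *
        (((#((kSubsets n k).filter fun A => q ≤ #(A ∩ V)) : ℕ) : ℝ≥0∞) * ((n ^ q : ℕ) : ℝ≥0∞))
      ≤ ((#(kSubsets n k) : ℕ) : ℝ≥0∞)⁻¹ *
          (((#(kSubsets n k) : ℕ) : ℝ≥0∞) * (((#V).choose q * (min k n) ^ q : ℕ) : ℝ≥0∞)) := by
        exact mul_le_mul' le_rfl (by exact_mod_cast hcount)
    _ = (((#V).choose q * (min k n) ^ q : ℕ) : ℝ≥0∞) := by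
        rw [← mul_assoc, ENNReal.inv_mul_cancel hne htop, one_mul]

/-- **Heavy-witness term, tail bound.** With threshold `t = C(j-1, 2)`: a term `E` heavy for `A` (more than `t`
slots inside `A`) meets `A` in at least `j` vertices (`card_filter_inside_le_choose`), so its heavy-witness term is
`≤ Pr_A[|A ∩ V(E)| ≥ j] ≤ C(v_E, j) d^j / n^j`. [folklore] -/
theorem dnf_termBound_tail (hn : 0 < n) (k j : ℕ) (E : Finset (⊤ : SimpleGraph (Fin n)).edgeSet) :
    ((#(kSubsets n k) : ℕ) : ℝ≥0∞)⁻¹ *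
      (∑ A ∈ kSubsets n k,
        if (j - 1).choose 2 < #(E.filter fun e : (⊤ : SimpleGraph (Fin n)).edgeSet => ∀ v ∈ (e : Sym2 (Fin n)), v ∈ A) then
          (erdosRenyiHalf n).toOuterMeasure {x | ∀ e ∈ E, plant A x e = true} else 0) ≤
      (((#(univ.filter fun v : Fin n => ∃ e ∈ E, v ∈ (e : Sym2 (Fin n)))).choose j * (min k n) ^ j : ℕ) :
          ℝ≥0∞) / ((n ^ j : ℕ) : ℝ≥0∞) := by
  classical
  set V := univ.filter fun v : Fin n => ∃ e ∈ E, v ∈ (e : Sym2 (Fin n)) with hV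
  refine le_trans (avg_kSubsets_le_card_filter k _ (fun A => j ≤ #(A ∩ V)) fun A _ => ?_)
    (avg_kSubsets_card_inter_ge_le hn k j V)
  split_ifs with hlt hj
  · exact ((MeasureTheory.OuterMeasure.mono _ (Set.subset_univ _)).trans_eq
        ((PMF.toOuterMeasure_apply_eq_one_iff _ _).2 (Set.subset_univ _)))
  · exfalso
    refine hj ?_
    have hle := card_filter_inside_le_choose A E
    rw [← hV] at hle
    by_contra hlt'
    have hAV : #(A ∩ V) ≤ j - 1 := by omega
    have := (hlt.trans_le hle).trans_le (Nat.choose_le_choose 2 hAV)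
    exact lt_irrefl _ this
  · exact bot_le
  · exact le_rfl

/-- `C(⌊√s⌋, 2) ≤ s / 2`. [folklore] -/
theorem choose_sqrt_two_le_half (s : ℕ) : (Nat.sqrt s).choose 2 ≤ s / 2 := by
  rw [Nat.choose_two_right]
  have h := Nat.sqrt_le' s
  rw [sq] at h
  refine Nat.div_le_div_right ?_
  calc Nat.sqrt s * (Nat.sqrt s - 1) ≤ Nat.sqrt s * Nat.sqrt s := Nat.mul_le_mul_left _ (Nat.sub_le _ _)
    _ ≤ s := h

/-- **Heavy-witness term, large-term bound.** For any threshold and any term `E` with `s` slots, `a = ⌊√s⌋`: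
if `A` meets `V(E)` in `≤ a` vertices then `E` has `≤ C(a,2) ≤ s/2` slots inside `A`, so
`Pr_x[E ⊆ plant A x] ≤ 2^{-(s - C(a,2))}`; otherwise charge `1`. Hence the heavy-witness term is
`≤ 2^{-(s - C(a,2))} + C(v_E, a+1) d^{a+1} / n^{a+1}`. [folklore] -/
theorem dnf_termBound_large (hn : 0 < n) (k t : ℕ) (E : Finset (⊤ : SimpleGraph (Fin n)).edgeSet) :
    ((#(kSubsets n k) : ℕ) : ℝ≥0∞)⁻¹ *
      (∑ A ∈ kSubsets n k,
        if t < #(E.filter fun e : (⊤ : SimpleGraph (Fin n)).edgeSet => ∀ v ∈ (e : Sym2 (Fin n)), v ∈ A) then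
          (erdosRenyiHalf n).toOuterMeasure {x | ∀ e ∈ E, plant A x e = true} else 0) ≤
      2⁻¹ ^ (#E - (Nat.sqrt #E).choose 2) +
        (((#(univ.filter fun v : Fin n => ∃ e ∈ E, v ∈ (e : Sym2 (Fin n)))).choose (Nat.sqrt #E + 1) *
            (min k n) ^ (Nat.sqrt #E + 1) : ℕ) : ℝ≥0∞) / ((n ^ (Nat.sqrt #E + 1) : ℕ) : ℝ≥0∞) := by
  classical
  set V := univ.filter fun v : Fin n => ∃ e ∈ E, v ∈ (e : Sym2 (Fin n)) with hV
  set a := Nat.sqrt #E with ha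
  set KS := kSubsets n k with hKS
  have hne := card_kSubsets_cast_ne_zero n k
  have htop : ((#KS : ℕ) : ℝ≥0∞) ≠ ⊤ := ENNReal.natCast_ne_top _
  -- pointwise split of the summand
  have hpt : ∀ A ∈ KS,
      (if t < #(E.filter fun e : (⊤ : SimpleGraph (Fin n)).edgeSet => ∀ v ∈ (e : Sym2 (Fin n)), v ∈ A) then
          (erdosRenyiHalf n).toOuterMeasure {x | ∀ e ∈ E, plant A x e = true} else 0) ≤
        2⁻¹ ^ (#E - a.choose 2) + (if a + 1 ≤ #(A ∩ V) then 1 else 0) := by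
    intro A _
    split_ifs with hlt hAV
    · exact le_add_left ((MeasureTheory.OuterMeasure.mono _ (Set.subset_univ _)).trans_eq
        ((PMF.toOuterMeasure_apply_eq_one_iff _ _).2 (Set.subset_univ _)))
    · rw [add_zero]
      -- `|A ∩ V| ≤ a`, so `E` has `≤ C(a,2)` slots inside `A`
      have hAV' : #(A ∩ V) ≤ a := by omega
      have hins : #(E.filter fun e : (⊤ : SimpleGraph (Fin n)).edgeSet => ∀ v ∈ (e : Sym2 (Fin n)), v ∈ A) ≤ a.choose 2 := by
        have h := card_filter_inside_le_choose A E
        rw [← hV] at h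
        exact h.trans (Nat.choose_le_choose 2 hAV')
      refine erdosRenyiHalf_le_half_pow_of_card_mul_le _ _ ?_
      have h := card_filter_plant_forall_mul_le A E
      refine le_trans ?_ h
      have hx : (univ.filter fun x : EdgeVec n => x ∈ {x : EdgeVec n | ∀ e ∈ E, plant A x e = true}) =
          univ.filter fun x : EdgeVec n => ∀ e ∈ E, plant A x e = true := by
        ext x; simp
      rw [hx]
      exact Nat.mul_le_mul_left _ (Nat.pow_le_pow_right two_pos (by omega))
    · exact bot_le
    · exact bot_le
  calc ((#KS : ℕ) : ℝ≥0∞)⁻¹ * ∑ A ∈ KS,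
        (if t < #(E.filter fun e : (⊤ : SimpleGraph (Fin n)).edgeSet => ∀ v ∈ (e : Sym2 (Fin n)), v ∈ A) then
          (erdosRenyiHalf n).toOuterMeasure {x | ∀ e ∈ E, plant A x e = true} else 0)
      ≤ ((#KS : ℕ) : ℝ≥0∞)⁻¹ * ∑ A ∈ KS,
          (2⁻¹ ^ (#E - a.choose 2) + (if a + 1 ≤ #(A ∩ V) then (1 : ℝ≥0∞) else 0)) := by
        gcongr with A hA
        exact hpt A hA
    _ = 2⁻¹ ^ (#E - a.choose 2) +
          ((#KS : ℕ) : ℝ≥0∞)⁻¹ * ((#(KS.filter fun A => a + 1 ≤ #(A ∩ V)) : ℕ) : ℝ≥0∞) := by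
        rw [sum_add_distrib, sum_const, nsmul_eq_mul, mul_add, ← mul_assoc,
          ENNReal.inv_mul_cancel hne htop, one_mul, ← sum_filter, sum_const, nsmul_eq_mul, mul_one]
    _ ≤ _ := by
        gcongr
        exact avg_kSubsets_card_inter_ge_le hn k (a + 1) V

end Summit.PneNP.PneNP.Theorems
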